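import Mathlib
import Literature.MathematicalPhysics.QuantumManyBody.BoseEinsteinCondensation

/-!
# Occupation transfer under pinning — what energy precision CAN certify

Solo seat `solo-AtomisticToContinuum-blind`, conjunct `BoseEinsteinCondensation`; `paper.md` §8 (session-7
addition R4 / attempt A64), the formal dual of the fragmentation no-go of `SoloBlindFragmentedStates` /
`SoloBlindFragmentedThermo` (energy windows of width `εN` contain states with `λ_max/N → 0`).

**The two-line lemma.** Pin a one-particle mode `φ` with strength `κ ≥ 0`: the pinned energy functional is
`E_κ(Ψ) = E(Ψ) − κ·n_φ(Ψ)` (`n_φ = occupation N φ` = `⟨φ, γ_Ψ φ⟩`). If `Ψ` is a `δ`-near-minimiser of `E_κ` and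
`Φ` is ANY trial state, then
`E₀ ≤ E(Ψ) = E_κ(Ψ) + κ n_φ(Ψ) ≤ E_κ(Φ) + δ + κ n_φ(Ψ) = E(Φ) − κ n_φ(Φ) + δ + κ n_φ(Ψ)`, i.e.
`κ·n_φ(Φ) ≤ κ·n_φ(Ψ) + (E(Φ) − E₀) + δ` (`mul_occupation_le_of_pinned`). So a trial state with occupation
`n_φ(Φ) ≥ m` and energy precision `E(Φ) ≤ E₀ + η` forces EVERY near-minimiser of the PINNED problem to have
`n_φ ≥ m − (η + δ)/κ` (`tsub_div_le_occupation_of_pinned`), hence `λ_max(γ_Ψ) ≥ m − (η+δ)/κ`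
(`tsub_div_le_maxOccupation_of_pinned`) and, in the `sup_δ inf`-packaging parallel to
`BoseGas.condensateNumber`, `pinnedCondensateOccupation ≥ m − η/κ` (`tsub_div_le_pinnedCondensateOccupation`).

**Reading (why this is recorded and why it is not a route).** With `m = (1 − s)N` and `η = (η₊ + η₋)N` (upper
trial-state precision plus lower-bound precision per particle) the pinned gas condenses in `φ` as soon as the
explicit one-body gap `κ` exceeds `2(η₊+η₋)/(1−s)` — energy precision buys condensation only AGAINST A GAP, at the
exchange rate "gap ≳ precision per particle"; `κ → 0` needs infinite-order precision. This is the Legendre-dual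
form of the saturation of the energy/localisation method (there the gap is the kinetic `R⁻²` of a box of side `R`),
and the exact complement of the fragmentation no-go: together they delimit what near-minimality can and cannot say
about `λ_max`. Everything is stated over the Literature objects `TrialState`, `energy`, `groundStateEnergy`,
`occupation`, `maxOccupation` in `ℝ≥0∞`; the pinned functional uses truncated subtraction, which is harmless under
the (physically automatic) hypothesis `κ·n_φ(Φ) ≤ E(Φ)` on the comparison state only.
-/

open MeasureTheory
open scoped ENNReal

namespace Summit.AtomisticToContinuum.BoseEinsteinCondensation.Theorems

open Literature.MathematicalPhysics.QuantumManyBody.BoseGas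

/-- The pinned energy functional `E_κ(Ψ) = ⟨Ψ, (H_N − κ a†(φ)a(φ)) Ψ⟩ = energy − κ · occupation` of a trial
state (truncated subtraction in `ℝ≥0∞`; exact whenever `κ · n_φ(Ψ) ≤ E(Ψ)`). -/
noncomputable def pinnedEnergy {N : ℕ} {L : ℝ} (v : ℝ → ℝ≥0∞) (κ : ℝ≥0∞) (φ : Space → ℂ)
    (Ψ : TrialState N L) : ℝ≥0∞ :=
  energy v Ψ - κ * occupation N φ Ψ.ψ

/-- The pinned ground-state energy `inf_Ψ E_κ(Ψ)`. -/
noncomputable def pinnedGroundStateEnergy (v : ℝ → ℝ≥0∞) (κ : ℝ≥0∞) (φ : Space → ℂ) (N : ℕ) (L : ℝ) :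
    ℝ≥0∞ :=
  ⨅ Ψ : TrialState N L, pinnedEnergy v κ φ Ψ

/-- The occupation of the pinned mode `φ` **in the pinned ground state**, packaged through minimising
sequences exactly as `BoseGas.condensateNumber`: `sup_{δ>0} inf { n_φ(Ψ) | E_κ(Ψ) ≤ inf E_κ + δ }`. -/
noncomputable def pinnedCondensateOccupation (v : ℝ → ℝ≥0∞) (κ : ℝ≥0∞) (φ : Space → ℂ) (N : ℕ)
    (L : ℝ) : ℝ≥0∞ :=
  ⨆ (δ : ℝ≥0∞) (_ : 0 < δ),
    ⨅ (Ψ : TrialState N L) (_ : pinnedEnergy v κ φ Ψ ≤ pinnedGroundStateEnergy v κ φ N L + δ),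
      occupation N φ Ψ.ψ

/-- `E(Ψ) ≤ E_κ(Ψ) + κ n_φ(Ψ)` (truncated subtraction). -/
theorem energy_le_pinnedEnergy_add {N : ℕ} {L : ℝ} (v : ℝ → ℝ≥0∞) (κ : ℝ≥0∞) (φ : Space → ℂ)
    (Ψ : TrialState N L) : energy v Ψ ≤ pinnedEnergy v κ φ Ψ + κ * occupation N φ Ψ.ψ :=
  le_tsub_add

/-- `E_κ(Φ) + κ n_φ(Φ) = E(Φ)` whenever `κ n_φ(Φ) ≤ E(Φ)` (the pinned functional is then exact). -/
theorem pinnedEnergy_add_eq {N : ℕ} {L : ℝ} (v : ℝ → ℝ≥0∞) {κ : ℝ≥0∞} {φ : Space → ℂ}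
    {Φ : TrialState N L} (h : κ * occupation N φ Φ.ψ ≤ energy v Φ) :
    pinnedEnergy v κ φ Φ + κ * occupation N φ Φ.ψ = energy v Φ :=
  tsub_add_cancel_of_le h

/-- The pinned ground-state energy is below the pinned energy of every trial state. -/
theorem pinnedGroundStateEnergy_le {N : ℕ} {L : ℝ} (v : ℝ → ℝ≥0∞) (κ : ℝ≥0∞) (φ : Space → ℂ)
    (Φ : TrialState N L) : pinnedGroundStateEnergy v κ φ N L ≤ pinnedEnergy v κ φ Φ :=
  iInf_le _ Φ

/-- **Occupation transfer under pinning (multiplicative form).** If `Φ` is a comparison trial state with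
finite energy, `κ n_φ(Φ) ≤ E(Φ)` and energy precision `E(Φ) ≤ E₀ + η`, and `Ψ` is a `δ`-near-minimiser of the
pinned functional `E − κ n_φ`, then `κ n_φ(Φ) ≤ κ n_φ(Ψ) + η + δ`. -/
theorem mul_occupation_le_of_pinned {N : ℕ} {L : ℝ} (v : ℝ → ℝ≥0∞) {κ η δ : ℝ≥0∞} {φ : Space → ℂ}
    {Φ Ψ : TrialState N L} (hΦfin : energy v Φ ≠ ⊤) (hΦκ : κ * occupation N φ Φ.ψ ≤ energy v Φ)
    (hη : energy v Φ ≤ groundStateEnergy v N L + η)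
    (hΨ : pinnedEnergy v κ φ Ψ ≤ pinnedGroundStateEnergy v κ φ N L + δ) :
    κ * occupation N φ Φ.ψ ≤ κ * occupation N φ Ψ.ψ + η + δ := by
  have h0fin : groundStateEnergy v N L ≠ ⊤ :=
    ne_top_of_le_ne_top hΦfin (groundStateEnergy_le_energy v Φ)
  -- E₀ + κ n(Φ) ≤ E(Ψ) + κ n(Φ) ≤ E_κ(Ψ) + κ n(Ψ) + κ n(Φ) ≤ E_κ(Φ) + δ + κ n(Ψ) + κ n(Φ) = E(Φ) + δ + κ n(Ψ)
  have h1 : groundStateEnergy v N L + κ * occupation N φ Φ.ψ ≤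
      groundStateEnergy v N L + (κ * occupation N φ Ψ.ψ + η + δ) := by
    calc groundStateEnergy v N L + κ * occupation N φ Φ.ψ
        ≤ energy v Ψ + κ * occupation N φ Φ.ψ :=
          add_le_add (groundStateEnergy_le_energy v Ψ) le_rfl
      _ ≤ (pinnedEnergy v κ φ Ψ + κ * occupation N φ Ψ.ψ) + κ * occupation N φ Φ.ψ :=
          add_le_add (energy_le_pinnedEnergy_add v κ φ Ψ) le_rfl
      _ ≤ (pinnedEnergy v κ φ Φ + δ + κ * occupation N φ Ψ.ψ) + κ * occupation N φ Φ.ψ := by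
          gcongr
          exact hΨ.trans (add_le_add (pinnedGroundStateEnergy_le v κ φ Φ) le_rfl)
      _ = (pinnedEnergy v κ φ Φ + κ * occupation N φ Φ.ψ) + κ * occupation N φ Ψ.ψ + δ := by ring
      _ = energy v Φ + κ * occupation N φ Ψ.ψ + δ := by rw [pinnedEnergy_add_eq v hΦκ]
      _ ≤ (groundStateEnergy v N L + η) + κ * occupation N φ Ψ.ψ + δ := by gcongr
      _ = groundStateEnergy v N L + (κ * occupation N φ Ψ.ψ + η + δ) := by ring
  exact (ENNReal.add_le_add_iff_left h0fin).mp h1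

/-- **Occupation transfer under pinning.** Under the hypotheses of `mul_occupation_le_of_pinned`, with
`0 < κ < ∞` and `m ≤ n_φ(Φ)`: every `δ`-near-minimiser of the pinned functional has `n_φ(Ψ) ≥ m − (η + δ)/κ`. -/
theorem tsub_div_le_occupation_of_pinned {N : ℕ} {L : ℝ} (v : ℝ → ℝ≥0∞) {κ η δ m : ℝ≥0∞}
    {φ : Space → ℂ} {Φ Ψ : TrialState N L} (hκ0 : κ ≠ 0) (hκT : κ ≠ ⊤) (hΦfin : energy v Φ ≠ ⊤)
    (hΦκ : κ * occupation N φ Φ.ψ ≤ energy v Φ) (hη : energy v Φ ≤ groundStateEnergy v N L + η)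
    (hm : m ≤ occupation N φ Φ.ψ)
    (hΨ : pinnedEnergy v κ φ Ψ ≤ pinnedGroundStateEnergy v κ φ N L + δ) :
    m - (η + δ) / κ ≤ occupation N φ Ψ.ψ := by
  have h := mul_occupation_le_of_pinned v hΦfin hΦκ hη hΨ
  have h' : κ * m ≤ κ * (occupation N φ Ψ.ψ + (η + δ) / κ) := by
    calc κ * m ≤ κ * occupation N φ Φ.ψ := by gcongr
      _ ≤ κ * occupation N φ Ψ.ψ + η + δ := h
      _ = κ * occupation N φ Ψ.ψ + κ * ((η + δ) / κ) := by
          rw [ENNReal.mul_div_cancel hκ0 hκT, add_assoc]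
      _ = κ * (occupation N φ Ψ.ψ + (η + δ) / κ) := by ring
  have h'' : m ≤ occupation N φ Ψ.ψ + (η + δ) / κ := (ENNReal.mul_le_mul_iff_right hκ0 hκT).mp h'
  exact tsub_le_iff_right.mpr h''

/-- The same bound for `λ_max(γ_Ψ)` of every near-minimiser of the pinned problem (`φ` normalised and
measurable). -/
theorem tsub_div_le_maxOccupation_of_pinned {N : ℕ} {L : ℝ} (v : ℝ → ℝ≥0∞) {κ η δ m : ℝ≥0∞}
    {φ : Space → ℂ} (hφ : AEStronglyMeasurable φ volume) (hφ₁ : ∫⁻ x, (‖φ x‖₊ : ℝ≥0∞) ^ 2 = 1)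
    {Φ Ψ : TrialState N L} (hκ0 : κ ≠ 0) (hκT : κ ≠ ⊤) (hΦfin : energy v Φ ≠ ⊤)
    (hΦκ : κ * occupation N φ Φ.ψ ≤ energy v Φ) (hη : energy v Φ ≤ groundStateEnergy v N L + η)
    (hm : m ≤ occupation N φ Φ.ψ)
    (hΨ : pinnedEnergy v κ φ Ψ ≤ pinnedGroundStateEnergy v κ φ N L + δ) :
    m - (η + δ) / κ ≤ maxOccupation N Ψ.ψ :=
  (tsub_div_le_occupation_of_pinned v hκ0 hκT hΦfin hΦκ hη hm hΨ).trans
    (occupation_le_maxOccupation Ψ.ψ hφ hφ₁)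

/-- **Pinned condensation from energy precision** (`sup_δ inf` packaging): a comparison state with
`n_φ(Φ) ≥ m`, `κ n_φ(Φ) ≤ E(Φ) < ∞` and `E(Φ) ≤ E₀ + η` gives `pinnedCondensateOccupation ≥ m − (η + δ)/κ` for
every `δ > 0`. -/
theorem tsub_div_le_pinnedCondensateOccupation_of_pos {N : ℕ} {L : ℝ} (v : ℝ → ℝ≥0∞) {κ η δ m : ℝ≥0∞}
    {φ : Space → ℂ} {Φ : TrialState N L} (hκ0 : κ ≠ 0) (hκT : κ ≠ ⊤) (hΦfin : energy v Φ ≠ ⊤)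
    (hΦκ : κ * occupation N φ Φ.ψ ≤ energy v Φ) (hη : energy v Φ ≤ groundStateEnergy v N L + η)
    (hm : m ≤ occupation N φ Φ.ψ) (hδ : 0 < δ) :
    m - (η + δ) / κ ≤ pinnedCondensateOccupation v κ φ N L :=
  le_iSup₂_of_le (f := fun δ _ => ⨅ (Ψ : TrialState N L)
      (_ : pinnedEnergy v κ φ Ψ ≤ pinnedGroundStateEnergy v κ φ N L + δ), occupation N φ Ψ.ψ) δ hδ
    (le_iInf₂ fun _ hΨ => tsub_div_le_occupation_of_pinned v hκ0 hκT hΦfin hΦκ hη hm hΨ)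

/-- **Pinned condensation from energy precision**, `δ`-free form: `pinnedCondensateOccupation ≥ m − η/κ`. -/
theorem tsub_div_le_pinnedCondensateOccupation {N : ℕ} {L : ℝ} (v : ℝ → ℝ≥0∞) {κ η m : ℝ≥0∞}
    {φ : Space → ℂ} {Φ : TrialState N L} (hκ0 : κ ≠ 0) (hκT : κ ≠ ⊤) (hΦfin : energy v Φ ≠ ⊤)
    (hΦκ : κ * occupation N φ Φ.ψ ≤ energy v Φ) (hη : energy v Φ ≤ groundStateEnergy v N L + η)
    (hm : m ≤ occupation N φ Φ.ψ) :
    m - η / κ ≤ pinnedCondensateOccupation v κ φ N L := by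
  refine ENNReal.le_of_forall_pos_le_add fun ε hε _ => ?_
  -- use δ = ε κ : then (η + δ)/κ = η/κ + ε
  have hδ : (0 : ℝ≥0∞) < (ε : ℝ≥0∞) * κ := ENNReal.mul_pos (by exact_mod_cast hε.ne') hκ0
  have h := tsub_div_le_pinnedCondensateOccupation_of_pos v hκ0 hκT hΦfin hΦκ hη hm hδ
  have hsplit : (η + (ε : ℝ≥0∞) * κ) / κ = η / κ + (ε : ℝ≥0∞) := by
    rw [ENNReal.add_div, ENNReal.mul_div_cancel_right hκ0 hκT]
  rw [hsplit] at h
  calc m - η / κ ≤ (m - (η / κ + ε)) + ε := by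
        rw [tsub_le_iff_right, add_assoc]
        exact le_tsub_add.trans (by rw [add_comm (ε : ℝ≥0∞) (η / κ)])
    _ ≤ pinnedCondensateOccupation v κ φ N L + ε := add_le_add h le_rfl

end Summit.AtomisticToContinuum.BoseEinsteinCondensation.Theorems
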